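import Summits.HodgeConjecture.HodgeConjecture.Theses.So7OddThetaNulls

/-!
# Root-transport skeleton for the REPAIRED crux `OddThetaNulls16` (strategist sketch)

`OddThetaNulls` (stmt-HodgeConjecture-18788) fails for the 8 characteristics `(a,b)` with
`a₇ = 0, b₇ = 1` (see `RefuteCheck.lean`, REFUTATION.md).  For the other 16 it holds on every
shell `H₀ ≤ 300` (56k–69k buckets each) and this file is the checked skeleton of a proof:

* an admissible Cayley root `t` (`t ∈ Λ_T`, `q(t) = -8`, `t₅` odd) orthogonal to the index `H`
  gives the integral Clifford transport `M_t = ω·R(t)/8`, whose induced isometry of the index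
  space is PROPER but agrees with the improper Cayley flip on `H` itself; on summation indices it
  is the affine map `tau t a`;
* `TransportGeom`: `tau t a` maps `bucket a H` injectively into `bucket a (flipQ H)`
  (a polynomial identity `quadVec (R(t) y) = q(t)·s₀(s_t(quadVec y))` + exact divisions);
* `TransportSign`: it reverses the sign character of the 16 characteristics — a pure 2-adic
  statement (orthogonality is only used mod 64; false for the 8 dropped characteristics);
* `RootCover`: every index carrying a non-empty bucket has an admissible orthogonal root
  (the Diophantine heart: the negative-definite quaternary lattice `(H^⊥ ∩ Λ_T)/ℤH♭` represents
  `-8` with `t₅` odd; numerically it does so by exactly one `±` pair for all 12308 buckets with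
  `H₀ ≤ 116`).

`OddThetaNulls16_of` is the sorry-free composition.  Stubs are `def … : Prop` hypotheses here
(nothing is registered against the refuted crux); when the route is repaired with a 16-character
crux this file becomes its `Lines/root-transport.lean` with `theorem stub_… := by sorry`.
-/

open Literature.NumberTheory.ModularForms.So7KugaSatake
open Finset

namespace Summit.HodgeConjecture.HodgeConjecture.Cruxes.OddThetaNulls.RootTransport

/-- the 16 characteristics that survive: drop `(a,b)` with `a₇ = 0` and `b₇ = 1`. -/
def chars16 : Finset (ℕ × ℕ) := chars.filter fun ab => ab.1.testBit 7 || !ab.2.testBit 7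

theorem card_chars16 : chars16.card = 16 := by decide

theorem chars16_subset : chars16 ⊆ chars := Finset.filter_subset _ _

/-- the repaired crux candidate: the 16 theta-nulls are odd under the Cayley flip. -/
def OddThetaNulls16 : Prop :=
  ∀ ab ∈ chars16, ∀ H : Fin 6 → ℤ, thetaCoeff ab.1 ab.2 (flipQ H) = -thetaCoeff ab.1 ab.2 H

/-- the Minkowski form of signature (1,5) on the index space (`8H₀² = 8H₁² + 4(H₂²+H₃²+H₄²) + H₅²`
on the support is `qform♭ = 0`). -/
def qform (t : Fin 6 → ℤ) : ℤ :=
  t 0 ^ 2 - t 1 ^ 2 - 2 * (t 2 ^ 2 + t 3 ^ 2 + t 4 ^ 2) - 8 * t 5 ^ 2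

/-- the natural pairing of a root with an index. -/
def pairing (t H : Fin 6 → ℤ) : ℤ := ∑ i, t i * H i

/-- admissible Cayley roots: the integrality lattice `Λ_T` (which makes `ω·R(t)/8` integral and
coset-preserving), norm `-8`, last coordinate odd. -/
def IsAdmRoot (t : Fin 6 → ℤ) : Prop :=
  t 0 % 4 = 0 ∧ (t 0 + t 1) % 8 = 0 ∧ t 2 % 4 = 0 ∧ t 3 % 4 = 0 ∧ t 4 % 4 = 0 ∧ t 5 % 2 = 1 ∧
    qform t = -8

/-- the Clifford vector `R(t) = t₀·1 + Σ_{i ≥ 1} tᵢ Rᵢ` (`R(t) R(t̄) = qform t · 1`). -/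
def Rvec (t : Fin 6 → ℤ) : Matrix (Fin 8) (Fin 8) ℤ :=
  t 0 • (1 : Matrix (Fin 8) (Fin 8) ℤ) + t 1 • cliffR 1 + t 2 • cliffR 2 + t 3 • cliffR 3 +
    t 4 • cliffR 4 + t 5 • cliffR 5

/-- the transport matrix `M_t = ω · R(t) / 8` (entrywise division, exact for `t ∈ Λ_T`). -/
def transportMat (t : Fin 6 → ℤ) : Matrix (Fin 8) (Fin 8) ℤ :=
  (cliffOmega * Rvec t).map fun x => x / 8

/-- the transport on summation indices: `m ↦ (M_t (2m + a) - a) / 2`. -/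
def tau (t : Fin 6 → ℤ) (a : ℕ) (m : Fin 8 → ℤ) : Fin 8 → ℤ :=
  fun i => ((transportMat t).mulVec (charVec a m) i - bitVec a i) / 2

/-- STUB 1 (geometry; M): for an admissible root orthogonal to `H`, `tau t a` maps `bucket a H`
injectively into `bucket a (flipQ H)`.  Content: `M_t` is in `GL₈(ℤ)` and preserves `a + 2ℤ⁸`
(needs `t₀ ≡ 0 mod 4`), the polynomial identity `quadVec (M_t y) = flipQ (quadVec y)` when
`pairing t (quadVec y) = 0`, and completeness of `box`. -/
def TransportGeom : Prop :=
  ∀ ab ∈ chars16, ∀ H t : Fin 6 → ℤ, IsAdmRoot t → pairing t H = 0 →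
    Set.InjOn (tau t ab.1) ↑(bucket ab.1 H) ∧ ∀ m ∈ bucket ab.1 H, tau t ab.1 m ∈ bucket ab.1 (flipQ H)

/-- STUB 2 (sign; M, purely 2-adic): the transport reverses the sign character of each of the 16
characteristics; only orthogonality mod 64 is used (0 failures on 2·10⁵ random `(t,m)`;
FALSE for the 8 dropped characteristics, whose character sees `m₇`). -/
def TransportSign : Prop :=
  ∀ ab ∈ chars16, ∀ (t : Fin 6 → ℤ) (m : Fin 8 → ℤ), IsAdmRoot t →
    pairing t (quadVec (charVec ab.1 m)) % 64 = 0 → termSign ab.2 (tau t ab.1 m) = -termSign ab.2 m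

/-- STUB 3 (cover; L, the Diophantine heart): every index with a non-empty bucket has an
admissible orthogonal root. -/
def RootCover : Prop :=
  ∀ ab ∈ chars16, ∀ H : Fin 6 → ℤ, (bucket ab.1 H).Nonempty → ∃ t, IsAdmRoot t ∧ pairing t H = 0

/-- one direction of the comparison: an injective bucket map bounds the cardinalities. -/
theorem card_le_of_transport {a : ℕ} {H : Fin 6 → ℤ} {t : Fin 6 → ℤ}
    (hinj : Set.InjOn (tau t a) ↑(bucket a H))
    (hmem : ∀ m ∈ bucket a H, tau t a m ∈ bucket a (flipQ H)) :
    (bucket a H).card ≤ (bucket a (flipQ H)).card := by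
  calc (bucket a H).card = ((bucket a H).image (tau t a)).card :=
        (Finset.card_image_of_injOn hinj).symm
    _ ≤ (bucket a (flipQ H)).card := by
        apply Finset.card_le_card
        intro x hx
        obtain ⟨m, hm, rfl⟩ := Finset.mem_image.1 hx
        exact hmem m hm

/-- COMPOSITION (sorry-free): the three stubs give the repaired crux. -/
theorem OddThetaNulls16_of (hG : TransportGeom) (hS : TransportSign) (hC : RootCover) :
    OddThetaNulls16 := by
  -- the relation on every index whose bucket is non-empty
  have key : ∀ ab ∈ chars16, ∀ H : Fin 6 → ℤ, (bucket ab.1 H).Nonempty →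
      thetaCoeff ab.1 ab.2 (flipQ H) = -thetaCoeff ab.1 ab.2 H := by
    intro ab hab H hne
    obtain ⟨t, ht, horth⟩ := hC ab hab H hne
    obtain ⟨hinj, hmem⟩ := hG ab hab H t ht horth
    have hne' : (bucket ab.1 (flipQ H)).Nonempty := by
      obtain ⟨m, hm⟩ := hne
      exact ⟨_, hmem m hm⟩
    obtain ⟨t', ht', horth'⟩ := hC ab hab (flipQ H) hne'
    obtain ⟨hinj', hmem'⟩ := hG ab hab (flipQ H) t' ht' horth'
    have h2 : (bucket ab.1 (flipQ H)).card ≤ (bucket ab.1 H).card := by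
      have := card_le_of_transport hinj' hmem'
      rwa [flipQ_flipQ] at this
    have himg : (bucket ab.1 H).image (tau t ab.1) = bucket ab.1 (flipQ H) := by
      apply Finset.eq_of_subset_of_card_le
      · intro x hx
        obtain ⟨m, hm, rfl⟩ := Finset.mem_image.1 hx
        exact hmem m hm
      · rw [Finset.card_image_of_injOn hinj]
        exact h2
    have hsign : ∀ m ∈ bucket ab.1 H, termSign ab.2 (tau t ab.1 m) = -termSign ab.2 m := by
      intro m hm
      have hq : quadVec (charVec ab.1 m) = H := by
        unfold bucket at hm
        exact (Finset.mem_filter.1 hm).2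
      exact hS ab hab t m ht (by rw [hq, horth]; decide)
    unfold thetaCoeff
    rw [← himg, Finset.sum_image (fun x hx y hy hxy => hinj hx hy hxy),
      Finset.sum_congr rfl hsign, Finset.sum_neg_distrib]
  intro ab hab H
  by_cases hne : (bucket ab.1 H).Nonempty
  · exact key ab hab H hne
  · by_cases hne' : (bucket ab.1 (flipQ H)).Nonempty
    · have := key ab hab (flipQ H) hne'
      rw [flipQ_flipQ] at this
      -- this : thetaCoeff H = -thetaCoeff (flipQ H)
      rw [this, neg_neg]
    · rw [Finset.not_nonempty_iff_eq_empty] at hne hne'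
      unfold thetaCoeff
      rw [hne, hne', Finset.sum_empty, neg_zero]

/-- The repaired crux is literally `OddThetaNulls` with `chars16` in place of `chars`. -/
example : OddThetaNulls16 ↔
    ∀ ab ∈ chars16, ∀ H : Fin 6 → ℤ, thetaCoeff ab.1 ab.2 (flipQ H) = -thetaCoeff ab.1 ab.2 H :=
  Iff.rfl

end Summit.HodgeConjecture.HodgeConjecture.Cruxes.OddThetaNulls.RootTransport
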